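import Literature.Analysis.FluidPDE.OseenMildWindowRepresentative
import Literature.Analysis.FluidPDE.KNSSRegularityGluing
import HarnessLib

/-!
# Route HardyPointSink — `HardyAncientLimit`, step 5: the blow-up limit is a mild bounded ancient
# solution

Support file for item stmt-NavierStokesRegularity-9138 (`HardyAncientLimit`) of route
`HardyPointSink` (problem `NavierStokesRegularity`).

The mildness step of the forward direction of Albritton–Barker 2019, Thm. 1.1 (§3: "such a
solution … gives rise to a non-trivial mild bounded ancient solution"), for a bounded weak
solution of Koch–Nadirashvili–Seregin–Šverák on `ℝ³ × ]-∞, 0[` whose slices obey the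
scale-invariant Morrey bound `∫_{B(0, m)} |w(t)|² ≤ I m` (which the Hardy bound provides):

* `HardyAncientLimit.exists_oseenMild_repr_of_boundedWeak` — the pressure-free form of the tree's
  `exists_oseenMild_repr_window`: on a window `(0, T)`, a bounded weak solution with the Morrey
  bound is a.e. equal to a continuous field solving the Oseen integral equation
  `v(t) = e^{(t−s)Δ}v(s) − B¹ₛ(v, v)(t)` (KNSS 2009, Lemma 3.1, `KNSS2009_weak_driftMild_holds`;
  the Morrey bound kills the parasitic drift, `IsKNSSDriftMild.exists_zeroDrift_of_morrey`);
* `HardyAncientLimit.oseenMild_of_boundedWeak_ancient` — hence a CONTINUOUS bounded weak ancient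
  solution with the Morrey bound has weakly divergence-free slices at every `t < 0` and solves
  the Oseen equation between all pairs `s < t < 0`;
* `HardyAncientLimit.isMildNSSolutionBetween_of_oseen`, `isBoundedAncientMildSolution_of_oseen` — the
  Oseen form implies the two-time duality ("very weak") form of the tree
  (Fabes–Jones–Rivière 1972; Lemarié-Rieusset 2016, Thm. 6.1; the proof of
  `IsTypeIAncientMild.isMildNSSolutionBetween` verbatim, with a uniform bound in place of the
  Type I rate).

## References

* D. Albritton, T. Barker, arXiv:1811.00502, §3.
* G. Koch, N. Nadirashvili, G. Seregin, V. Šverák, Acta Math. 203 (2009), Lemma 3.1, §4, Rem. 4.1.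
* P. G. Lemarié-Rieusset, *The Navier–Stokes Problem in the 21st Century* (2016), Thm. 6.1.
-/

noncomputable section

open Literature.Analysis.FluidPDE Literature.Analysis
open MeasureTheory Set Function Filter Topology Metric TopologicalSpace
open scoped ENNReal NNReal InnerProductSpace RealInnerProductSpace

namespace Summit.NavierStokesRegularity.NavierStokesRegularity.Theorems

namespace HardyAncientLimit

/-! ### The window representative, pressure-free form -/

/-- **Continuous Oseen-mild representative of a bounded weak solution with the Morrey bound, on a
window** — the pressure-free form of the tree's `exists_oseenMild_repr_window` (whose proof uses
the pressure only to produce the bounded weak solution). Let `u` be a bounded weak solution of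
Navier–Stokes (`ν = 1`, KNSS class) on `(0, T) × ℝ³` with `‖u(t, x)‖ ≤ M`, and suppose
`∫_{B(0, m)} ‖u(t)‖² ≤ I m` for all integers `m ≥ m₀` at a.e. `t ∈ (0, T)`. Then `u` is a.e. equal on
the strip to a field `v`, continuous on `(0, T) × ℝ³`, with weakly divergence-free slices at every
`t ∈ (0, T)`, solving `v(t, x) = e^{(t−s)Δ}v(s)(x) − B¹ₛ(v, v)(t)(x)` for all `0 < s < t < T`.
Proof: KNSS's Lemma 3.1 (`KNSS2009_weak_driftMild_holds`) writes `u = U + b(t)` a.e. with `(U, b)`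
drift-mild; the Morrey bound kills the drift (`IsKNSSDriftMild.exists_zeroDrift_of_morrey`);
zero-drift drift-mild fields are continuous, weakly divergence free at every time, and Oseen-mild. -/
theorem exists_oseenMild_repr_of_boundedWeak {T : ℝ} (hT : 0 < T)
    {u : ℝ → EuclideanSpace ℝ (Fin 3) → EuclideanSpace ℝ (Fin 3)}
    (hbw : IsBoundedWeakNSSolutionOn (Ioo 0 T) isOpen_Ioo 1 u)
    {M : ℝ} (hM : ∀ t ∈ Ioo 0 T, ∀ x, ‖u t x‖ ≤ M) {I : ℝ} (hI : 0 ≤ I) {m₀ : ℕ}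
    (hMor : ∀ᵐ t ∂(volume.restrict (Ioo 0 T)), ∀ m : ℕ, m₀ ≤ m →
      ∫⁻ y in ball (0 : EuclideanSpace ℝ (Fin 3)) m, ‖u t y‖ₑ ^ 2 ≤ ENNReal.ofReal (I * m)) :
    ∃ v : ℝ → EuclideanSpace ℝ (Fin 3) → EuclideanSpace ℝ (Fin 3),
      ContinuousOn (uncurry v) (Ioo 0 T ×ˢ univ) ∧
      (∀ t ∈ Ioo 0 T, IsWeaklyDivFree (v t)) ∧
      (∀ s t : ℝ, 0 < s → s < t → t < T → ∀ x,
        v t x = UnboundedOperators.heatExtension (v s) (t - s) x - oseenDuhamel 1 s v v t x) ∧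
      (∀ᵐ z ∂(volume.restrict (Ioo 0 T ×ˢ (univ : Set (EuclideanSpace ℝ (Fin 3))))),
        uncurry u z = uncurry v z) := by
  -- ## Lemma 3.1
  obtain ⟨N, hN⟩ := KNSS2009_weak_driftMild_holds M T hT
  obtain ⟨U, b, hUb, hae⟩ := hN hbw hM
  -- ## the Morrey bound, transported to `U + b`, kills the drift
  have hMor' : ∀ᵐ τ ∂(volume.restrict (Ioo 0 T)), ∀ m : ℕ, m₀ ≤ m →
      ∫⁻ y in ball (0 : EuclideanSpace ℝ (Fin 3)) m, ‖U τ y + b τ‖ₑ ^ 2 ≤ ENNReal.ofReal (I * m) := by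
    filter_upwards [hMor, hae] with τ hτ hτae m hm
    have e : ∫⁻ y in ball (0 : EuclideanSpace ℝ (Fin 3)) m, ‖U τ y + b τ‖ₑ ^ 2 =
        ∫⁻ y in ball (0 : EuclideanSpace ℝ (Fin 3)) m, ‖u τ y‖ₑ ^ 2 :=
      lintegral_congr_ae (ae_restrict_of_ae (hτae.mono fun y hy => by
        show ‖U τ y + b τ‖ₑ ^ 2 = ‖u τ y‖ₑ ^ 2
        rw [hy]))
    rw [e]
    exact hτ m hm
  obtain ⟨V, hV, hVae⟩ := hUb.exists_zeroDrift_of_morrey hI hMor'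
  -- `u(τ) = V(τ)` a.e. in space for a.e. `τ`, hence a.e. on the strip
  have hslice : ∀ᵐ τ ∂(volume.restrict (Ioo 0 T)), u τ =ᵐ[volume] V τ := by
    filter_upwards [hae, hVae] with τ h1 h2
    exact h1.mono fun y hy => by
      show u τ y = V τ y
      rw [hy]
      exact h2 y
  have hstrip : uncurry u =ᵐ[volume.restrict (Ioo 0 T ×ˢ (univ : Set (EuclideanSpace ℝ (Fin 3))))]
      uncurry V := by
    have hm1 : AEStronglyMeasurable (uncurry u)
        (((volume : Measure ℝ).restrict (Ioo 0 T)).prod (volume : Measure (EuclideanSpace ℝ (Fin 3)))) := by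
      have h := hbw.aestronglyMeasurable
      rwa [volume_restrict_slab_eq] at h
    have hm2 : AEStronglyMeasurable (uncurry V)
        (((volume : Measure ℝ).restrict (Ioo 0 T)).prod (volume : Measure (EuclideanSpace ℝ (Fin 3)))) :=
      hV.measurable.aestronglyMeasurable
    rw [volume_restrict_slab_eq]
    exact ae_eq_prod_of_ae_slice_ae_eq hm1 hm2 hslice
  refine ⟨V, hV.continuousOn_uncurry, fun t ht => hV.isWeaklyDivFree_of_mem ht,
    fun s t hs hst htT x => (hV.eq_heatExtension_sub_oseenDuhamel_three hs hst htT).1 x, hstrip⟩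

/-! ### Ancient continuous bounded weak solutions with the Morrey bound are Oseen-mild -/

/-- **A continuous bounded weak ancient solution with the Morrey bound is Oseen-mild** (Albritton–
Barker 2019, §3; KNSS 2009, Lemma 3.1 and §4): if `w` is a bounded weak solution of Navier–Stokes
(`ν = 1`, KNSS class) on `ℝ³ × ]-∞, 0[`, continuous on the open half-space, with
`∫_{B(0, m)} ‖w(t)‖² ≤ I m` for all integers `m ≥ m₀` and all `t < 0`, then every slice `w(t)`,
`t < 0`, is weakly divergence free and `w(t, x) = e^{(t−s)Δ}w(s)(x) − B¹ₛ(w, w)(t)(x)` for all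
`s < t < 0` and all `x` (on each window `]-(n+1), 0[` the continuous Oseen-mild representative of
`exists_oseenMild_repr_of_boundedWeak` coincides with `w`, two continuous functions a.e. equal on
an open set being equal). -/
theorem oseenMild_of_boundedWeak_ancient
    {w : ℝ → EuclideanSpace ℝ (Fin 3) → EuclideanSpace ℝ (Fin 3)}
    (hw : IsBoundedWeakNSSolutionOn (Iio 0) isOpen_Iio 1 w)
    (hcont : ContinuousOn (uncurry w) (Iio 0 ×ˢ univ))
    {M : ℝ} (hM : ∀ t < 0, ∀ x, ‖w t x‖ ≤ M) {I : ℝ} (hI : 0 ≤ I) {m₀ : ℕ}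
    (hMor : ∀ t < 0, ∀ m : ℕ, m₀ ≤ m →
      ∫⁻ y in ball (0 : EuclideanSpace ℝ (Fin 3)) m, ‖w t y‖ₑ ^ 2 ≤ ENNReal.ofReal (I * m)) :
    (∀ t < 0, IsWeaklyDivFree (w t)) ∧
      ∀ s t : ℝ, s < t → t < 0 → ∀ x,
        w t x = UnboundedOperators.heatExtension (w s) (t - s) x - oseenDuhamel 1 s w w t x := by
  -- ## the window `]a, 0[`, `a = -(n+1)`, shifted to `]0, n+1[`
  have hwin : ∀ n : ℕ,
      (∀ τ ∈ Ioo (0 : ℝ) ((n : ℝ) + 1), IsWeaklyDivFree (w (τ + (-((n : ℝ) + 1))))) ∧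
      ∀ σ τ : ℝ, 0 < σ → σ < τ → τ < (n : ℝ) + 1 → ∀ x,
        w (τ + (-((n : ℝ) + 1))) x =
          UnboundedOperators.heatExtension (w (σ + (-((n : ℝ) + 1)))) (τ - σ) x -
            oseenDuhamel 1 σ (fun θ => w (θ + (-((n : ℝ) + 1))))
              (fun θ => w (θ + (-((n : ℝ) + 1)))) τ x := by
    intro n
    set a : ℝ := -((n : ℝ) + 1) with ha
    have hTa : 0 < -a := by rw [ha, neg_neg]; positivity
    have hJI : ∀ τ : ℝ, τ ∈ Ioo 0 (-a) ↔ τ + a ∈ Ioo a 0 := fun τ => by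
      constructor
      · rintro ⟨h1, h2⟩; exact ⟨by linarith, by linarith⟩
      · rintro ⟨h1, h2⟩; exact ⟨by linarith, by linarith⟩
    set ua : ℝ → EuclideanSpace ℝ (Fin 3) → EuclideanSpace ℝ (Fin 3) := fun τ => w (τ + a) with hua
    have hbw : IsBoundedWeakNSSolutionOn (Ioo 0 (-a)) isOpen_Ioo 1 ua :=
      (hw.mono isOpen_Ioo Ioo_subset_Iio_self).comp_add_right a isOpen_Ioo hJI
    have hMa : ∀ τ ∈ Ioo 0 (-a), ∀ x, ‖ua τ x‖ ≤ M := fun τ hτ x =>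
      hM (τ + a) ((hJI τ).1 hτ).2 x
    have hMora : ∀ᵐ τ ∂(volume.restrict (Ioo 0 (-a))), ∀ m : ℕ, m₀ ≤ m →
        ∫⁻ y in ball (0 : EuclideanSpace ℝ (Fin 3)) m, ‖ua τ y‖ₑ ^ 2 ≤ ENNReal.ofReal (I * m) := by
      filter_upwards [ae_restrict_mem measurableSet_Ioo] with τ hτ m hm
      exact hMor (τ + a) ((hJI τ).1 hτ).2 m hm
    obtain ⟨v, hvc, hvdiv, hvmild, hvae⟩ := exists_oseenMild_repr_of_boundedWeak hTa hbw hMa hI hMora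
    -- `ua` is continuous on the open strip, hence `v = ua` there
    have huac : ContinuousOn (uncurry ua) (Ioo 0 (-a) ×ˢ univ) := by
      refine hcont.comp (f := fun q : ℝ × EuclideanSpace ℝ (Fin 3) => (q.1 + a, q.2))
        ((continuous_fst.add continuous_const).prodMk continuous_snd).continuousOn ?_
      intro q hq
      exact ⟨((hJI q.1).1 hq.1).2, mem_univ _⟩
    have heq : EqOn (uncurry v) (uncurry ua) (Ioo 0 (-a) ×ˢ univ) :=
      Measure.eqOn_open_of_ae_eq (hvae.mono fun z hz => hz.symm) (isOpen_Ioo.prod isOpen_univ)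
        hvc huac
    have heq' : ∀ τ ∈ Ioo 0 (-a), v τ = ua τ := fun τ hτ =>
      funext fun x => heq (mk_mem_prod hτ (mem_univ x))
    have hna : (n : ℝ) + 1 = -a := by rw [ha]; ring
    refine ⟨fun τ hτ => ?_, fun σ τ hσ hστ hτ x => ?_⟩
    · rw [hna] at hτ
      have h := hvdiv τ hτ
      rw [heq' τ hτ] at h
      exact h
    · rw [hna] at hτ
      have hσI : σ ∈ Ioo 0 (-a) := ⟨hσ, hστ.trans hτ⟩
      have hτI : τ ∈ Ioo 0 (-a) := ⟨hσ.trans hστ, hτ⟩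
      have h := hvmild σ τ hσ hστ hτ x
      rw [heq' τ hτI, heq' σ hσI] at h
      rw [oseenDuhamel_congr_ae_slice (u' := v) (v' := v)
        (fun θ hθ => Eventually.of_forall fun y => by
          rw [heq' θ ⟨hσ.trans hθ.1, hθ.2.trans hτ⟩])
        (fun θ hθ => Eventually.of_forall fun y => by
          rw [heq' θ ⟨hσ.trans hθ.1, hθ.2.trans hτ⟩]) x]
      exact h
  -- ## back to the original time variable
  refine ⟨fun t ht => ?_, fun s t hst ht x => ?_⟩
  · obtain ⟨n, hn⟩ := exists_nat_gt (-t)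
    have h := (hwin n).1 (t + ((n : ℝ) + 1)) ⟨by linarith, by linarith⟩
    simpa only [add_neg_cancel_right] using h
  · obtain ⟨n, hn⟩ := exists_nat_gt (-s)
    set δ : ℝ := (n : ℝ) + 1 with hδ
    have h := (hwin n).2 (s + δ) (t + δ) (by rw [hδ]; linarith) (by linarith) (by rw [hδ]; linarith) x
    have e : (fun θ => w (θ + -δ)) = fun θ => w (θ - δ) := by
      funext θ
      rw [sub_eq_add_neg]
    rw [e, oseenDuhamel_comp_sub_right, add_sub_cancel_right, add_sub_cancel_right,
      add_neg_cancel_right, add_neg_cancel_right, add_sub_add_right_eq_sub] at h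
    exact h

/-! ### The Oseen form implies the duality form -/

/-- **An Oseen-mild continuous bounded ancient field satisfies the two-time duality identity**
`IsMildNSSolutionBetween 1 0 w s t` for all `s < t < 0` (Oseen integral form ⇒ very weak form;
Lemarié-Rieusset 2016, Thm. 6.1, (6.12) ⇒ (6.11); KNSS 2009, Rem. 4.1). The proof of
`IsTypeIAncientMild.isMildNSSolutionBetween`, with the uniform bound `M` in place of the Type I
rate. -/
theorem isMildNSSolutionBetween_of_oseen
    {w : ℝ → EuclideanSpace ℝ (Fin 3) → EuclideanSpace ℝ (Fin 3)}
    (hcont : ContinuousOn (uncurry w) (Iio 0 ×ˢ univ))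
    {M : ℝ} (hM0 : 0 ≤ M) (hM : ∀ t < 0, ∀ x, ‖w t x‖ ≤ M)
    (hmild : ∀ s t : ℝ, s < t → t < 0 → ∀ x,
      w t x = UnboundedOperators.heatExtension (w s) (t - s) x - oseenDuhamel 1 s w w t x)
    {s t : ℝ} (hst : s < t) (ht : t < 0) :
    IsMildNSSolutionBetween 1 0 w s t := by
  intro φ hφ hdiv
  have hs : s < 0 := hst.trans ht
  have huM : ∀ τ ∈ Ioo s t, ∀ y, ‖w τ y‖ ≤ M := fun τ hτ y => hM τ (hτ.2.trans ht) y
  have hslice : ∀ {τ : ℝ}, τ < 0 → Continuous (w τ) := fun {τ} hτ =>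
    hcont.comp_continuous (continuous_const.prodMk continuous_id) fun x => ⟨hτ, mem_univ _⟩
  have hmeas : AEStronglyMeasurable (uncurry w)
      ((volume : Measure (ℝ × EuclideanSpace ℝ (Fin 3))).restrict (Ioo s t ×ˢ univ)) :=
    (hcont.mono (prod_mono (fun _ hτ => lt_trans hτ.2 ht) subset_rfl)).aestronglyMeasurable
      (measurableSet_Ioo.prod MeasurableSet.univ)
  have hφc : Continuous φ := hφ.contDiff.continuous
  -- the three tested identities
  have hB := integral_inner_oseenDuhamel_eq_neg_intervalIntegral one_pos hmeas hM0 huM hst le_rfl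
    hφ hdiv
  have hA := integral_inner_heatExtension_comm_of_bound (hslice hs).aestronglyMeasurable
    (fun x => hM s hs x) hφc hφ.hasCompactSupport (sub_pos.2 hst)
  have hut : ∀ x, w t x =
      UnboundedOperators.heatExtension (w s) (t - s) x - oseenDuhamel 1 s w w t x :=
    fun x => hmild s t hst ht x
  -- integrability of the three pairings
  obtain ⟨K, -, hK⟩ := exists_norm_oseenDuhamel_bounded_le (E := EuclideanSpace ℝ (Fin 3))
  have hiB : Integrable (fun x => ⟪oseenDuhamel 1 s w w t x, φ x⟫)
      (volume : Measure (EuclideanSpace ℝ (Fin 3))) :=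
    integrable_inner_of_norm_le_of_hasCompactSupport
      (aestronglyMeasurable_oseenDuhamel one_pos hmeas hmeas hM0 huM huM hst le_rfl)
      (fun x => hK one_pos hst hM0 huM huM x) hφc hφ.hasCompactSupport
  have hiU : Integrable (fun x => ⟪w t x, φ x⟫) (volume : Measure (EuclideanSpace ℝ (Fin 3))) :=
    integrable_inner_of_continuous_of_hasCompactSupport (hslice ht) hφc hφ.hasCompactSupport
  have hiA : Integrable
      (fun x => ⟪UnboundedOperators.heatExtension (w s) (t - s) x, φ x⟫)
      (volume : Measure (EuclideanSpace ℝ (Fin 3))) := by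
    refine (hiU.add hiB).congr (Eventually.of_forall fun x => ?_)
    simp only [Pi.add_apply, hut x, inner_sub_left, sub_add_cancel]
  -- assemble
  calc ∫ x, ⟪w t x, φ x⟫
      = ∫ x, (⟪UnboundedOperators.heatExtension (w s) (t - s) x, φ x⟫ -
          ⟪oseenDuhamel 1 s w w t x, φ x⟫) := by
        refine integral_congr_ae (Eventually.of_forall fun x => ?_)
        simp only [hut x, inner_sub_left]
    _ = (∫ x, ⟪UnboundedOperators.heatExtension (w s) (t - s) x, φ x⟫) -
          ∫ x, ⟪oseenDuhamel 1 s w w t x, φ x⟫ := integral_sub hiA hiB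
    _ = (∫ x, ⟪w s x, heatTest 1 φ (t - s) x⟫) +
          (∫ τ in s..t, ∫ x, ⟪w τ x, convect (w τ) (heatTest 1 φ (t - τ)) x⟫) +
          ∫ τ in s..t, ∫ x, ⟪(0 : ℝ → EuclideanSpace ℝ (Fin 3) → EuclideanSpace ℝ (Fin 3)) τ x,
            heatTest 1 φ (t - τ) x⟫ := by
        rw [hA, hB, heatTest_of_pos one_pos (sub_pos.2 hst), one_mul]
        simp

/-- **Oseen-mild continuous bounded ancient fields with weakly divergence-free slices are ancient
mild solutions in the duality sense** of the tree (`IsAncientMildSolution 1 w`; KNSS 2009, §6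
p. 11 with Rem. 4.1), and bounded ones (`IsBoundedAncientMildSolution 1 w`). -/
theorem isBoundedAncientMildSolution_of_oseen
    {w : ℝ → EuclideanSpace ℝ (Fin 3) → EuclideanSpace ℝ (Fin 3)}
    (hcont : ContinuousOn (uncurry w) (Iio 0 ×ˢ univ))
    {M : ℝ} (hM0 : 0 ≤ M) (hM : ∀ t < 0, ∀ x, ‖w t x‖ ≤ M)
    (hdiv : ∀ t < 0, IsWeaklyDivFree (w t))
    (hmild : ∀ s t : ℝ, s < t → t < 0 → ∀ x,
      w t x = UnboundedOperators.heatExtension (w s) (t - s) x - oseenDuhamel 1 s w w t x) :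
    IsBoundedAncientMildSolution 1 w :=
  ⟨⟨hdiv, fun _ _ hst ht => isMildNSSolutionBetween_of_oseen hcont hM0 hM hmild hst ht⟩,
    ⟨M, fun t ht x => hM t ht x⟩⟩

end HardyAncientLimit

end Summit.NavierStokesRegularity.NavierStokesRegularity.Theorems

end
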